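import Summits.QuantumFields.YangMills.Theorems.Instrument.BesselCapBoxesKZL2rp
import Summits.QuantumFields.YangMills.Theorems.Instrument.BesselCapLimitHankel
import Summits.QuantumFields.GaugeBoot.WordLoopZdLimit
import Summits.QuantumFields.GaugeBoot.Rows.KZL2rpD4WilsonLabels
import Summits.QuantumFields.GaugeBoot.WilsonLoopLimitHankelDiffTransfer
import HarnessLib

/-!
# YM instrument cell — `SU(2)`, `D = 4`: the CAP OBJECTS of the three R0 «LIMIT | cap» certificate files, typed at
# infinite-volume LIMIT POINTS (certificate→row identification; boot-plan ACT-D (T-a))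

Cell `ym-instrument` (HUMAN RULING D-0084 (2); director-ym R138; HOME `run/shared/lean/pub/ym-instrument/`), crew (a),
Lean typist seat `ym-instrument-boot-lean-1` (gen 3). Question Q-A1, amendment A-plan-11 «BESSEL CAP»; ladder consequence:
provenance of the three R0 «LIMIT | cap» rows of TABLE-A1 v1.5 (IR `stmt-QuantumFields-19354`, THE NUMBER) —
`SU2-D4-b9o5-kzL2rphkhdcap-LIM-lin-chi22-c3o2-lower` (cert e5c24dc8…; ℓ_c(3/2) ≥ −0.0642124814),
`SU2-D4-b9o5-kzL2rphkhdcap-LIM-lin-chi22-c2-lower` (e6784d78…; ℓ_c(2) ≥ −0.0626557540),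
`SU2-D4-b11o5-kzL2rphkhdcap-LIM-lin-chi22-c3o2-lower` (6fbac2c4…; ℓ_c(3/2) ≥ −0.0692848922); problem files
`certs/a/files/SU2-D4/kzL2rpLIMcap/SU2_D4_b9o5_kzL2rphkhdcap_LIM_lin-chi22-{c3o2,c2}_lower.problem1.json` (inner sha256
72f96e69… / fd8ee7cd…, data sha 7d80e3be…) and `SU2_D4_b11o5_…-c3o2_lower.problem1.json` (2fd6498b…, data 37b38f67…).
No number, read, grade or verdict moves (Q-A1 answer of record «NO — capped at R1 (+cap)», A-0826-42); the rows REMAIN class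
LIMIT. The R1 kz-L2r row (1062f51a…, 15 524 labels) is NOT covered (no typed kz-L2r label table).

HONEST FRAMING (page 1 of every file of this cell): WHAT IS CERTIFIED HERE, AT WHICH `(G, D, L, β)`: `G = SU(2)` (fundamental,
standard Wilson action, tree coupling `β/2`), `D = 4`, class LIMIT = infinite-volume limit points `μ` of the torus Wilson
states along strictly increasing sequences of tori `(ℤ/(L_k+1))⁴` (EVEN sides where stated), `β_std ∈ {9/5, 11/5}` (boxes
also at `2`, `12/5`). The VARIABLES of a class-LIMIT file are the limits `yLim μ v := ∫ W_0(label v) dμ` of the torus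
expectations `KZL2rpD4.y β L v = ⟨W_0(label v)⟩_{(ℤ/L)⁴}` (`tendsto_y_yLim`, from `GaugeBoot/WordLoopZdLimit`; the label
table `KZL2rpD4.label` is the column list of the files IN THE SAME ORDER — checked by the seat script `check_files.py`
against the three problem files: 10 878/10 878 columns equal). Typed here, hypothesis-free: (B) the PER-VARIABLE BOXES
`bounds.abs[v] = ρ^{m(v)}`: `|yLim μ v| ≤ ρ(β)^{|capWit v|}` for ALL `v` (`abs_yLim_le_pow_capWit_b9o5|_b2|_b11o5|_b12o5`,
the limit of `BesselCapBoxesKZL2rp.abs_y_le_pow_capWit_*`, p492638; script check: the files' 10 836 keyed rationals equal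
`ρ^{|capWit v|}` exactly, the 42 unkeyed columns have `|capWit v| = 0` and the default box `|yLim μ v| ≤ 1`, `abs_yLim_le_one`);
(D) the DICTIONARY `yLim μ 0 = 1`, `yLim μ 1 = g₁(1)`, `yLim μ 2 = g₁(2)`, `yLim μ 5 = g₁(3)`, `yLim μ 27 = g₁(4)`,
`yLim μ 13 = g₂(2)`, `yLim μ 2 = g₂(1)` (`g_m(t) = gLim μ 1 m t = ∫ W̄(t × m) dμ`, plane `(0,1)`; kernel facts
`label v = Word.rectangle 0 1 t m` + `WilsonLoopLimit.wilsonLoop_integral_limit_comm`); (C) the files' SIX CAP OBJECTS as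
theorems about their own variables at every limit point along even tori: `hdcap/R1/mono t=1,2,3`
(`yLim μ 2 ≤ ρ·yLim μ 1`, `yLim μ 5 ≤ ρ·yLim μ 2`, `yLim μ 27 ≤ ρ·yLim μ 5`), `hdcap/R2/mono t=1` (`yLim μ 13 ≤ ρ²·yLim μ 2`),
`hdcap/R1/D0cap{0..1}` and `hdcap/R1/D1cap{0..1}` (the two `2 × 2` capped difference-Hankel blocks, all real `c₀, c₁`), from
`BesselCapLimitHankel.limit_hdcap_*_one_b*` / `limit_monocap_*`. The other LIMIT row objects of these files (`hd/R·/convex`,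
`hk/R3/H1link`, `hankel-site`, `hankel-link` blocks) are the UNCAPPED class-LIMIT objects of record (`WilsonLoopLimitMonotone`,
`WilsonLoopLimitHankelDiff`). NOT typed here and NOT claimed: the kernel replay of the dual certificates themselves (the
certificate→theorem bind of a class-LIMIT row: loop equations and RP Gram blocks at limit points, dual multipliers) — the
rows stay CERTIFIED-CONDITIONAL exactly as every class-LIMIT row; what this file discharges BY NAME is the hypothesis
hBesselCap(ρ) of every cap object of the three R0 files. Fixed coupling; NOT an area law, string tension, mass gap or
continuum statement; no uniqueness of the limit; nothing summit-bearing.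
-/

noncomputable section

namespace Summit.QuantumFields.YangMills.Theorems.Instrument

open MeasureTheory Filter Topology Finset
open Summit.QuantumFields.GaugeBoot
open Summit.QuantumFields.GaugeBoot.WilsonLoopLimit
open Literature.MathematicalPhysics.QuantumFieldTheory
open Literature.MathematicalPhysics.QuantumLattice (LGConfig IsInfiniteVolumeLimitAlong wilsonLoopObs rectWalk
  normalisedCharacter)
open Literature.Analysis.FunctionSpaces (besselI)

/-! ## The class-LIMIT variables -/

/-- **The class-LIMIT variable of column `v`**: `yLim μ v := ∫ W_0(label v) dμ`, the `μ`-expectation of the based word loop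
of the kz-L2-rp-4D label `v` (`SU(2)`, fundamental, origin of `ℤ⁴`; tree `wordLoopZd`). [folklore] -/
def yLim (μ : Measure (LGConfig 4 (SU 2))) (v : Fin 10878) : ℝ :=
  ∫ U, wordLoopZd (suRep 2) (0 : Literature.Probability.LatticeModels.Site 4) (KZL2rpD4.label v) U ∂μ

/-- Unfolding `yLim` (by `rfl`). [folklore] -/
theorem yLim_eq (μ : Measure (LGConfig 4 (SU 2))) (v : Fin 10878) :
    yLim μ v = ∫ U, wordLoopZd (suRep 2) (0 : Literature.Probability.LatticeModels.Site 4) (KZL2rpD4.label v) U ∂μ :=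
  rfl

variable {β : ℝ} {Lk : ℕ → ℕ} {μ : Measure (LGConfig 4 (SU 2))}

/-- **The torus variables converge to the class-LIMIT variables**: `y β (L_k+1) v → yLim μ v` at every infinite-volume limit
point along `(ℤ/(L_k+1))⁴` (any `β`, any sequence). [folklore] -/
theorem tendsto_y_yLim (hμ : IsInfiniteVolumeLimitAlong (suRep 2) (β / (2 : ℕ)) Lk μ) (v : Fin 10878) :
    Tendsto (fun k => KZL2rpD4.y β (Lk k + 1) v) atTop (𝓝 (yLim μ v)) :=
  tendsto_wilsonExpectation_wordLoop_zero (suRep 2) (continuous_suRep 2) hμ (KZL2rpD4.label v)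

/-- **Unit column**: `yLim μ 0 = 1`. [folklore] -/
theorem yLim_zero (hμ : IsInfiniteVolumeLimitAlong (suRep 2) (β / (2 : ℕ)) Lk μ) : yLim μ 0 = 1 := by
  have h := tendsto_y_yLim hμ 0
  have e : (fun k => KZL2rpD4.y β (Lk k + 1) 0) = fun _ => (1 : ℝ) := funext fun k => KZL2rpD4.y_zero β (Lk k + 1)
  rw [e] at h
  exact tendsto_nhds_unique h tendsto_const_nhds

/-- **Default box** `|yLim μ v| ≤ 1` for every column (the 42 columns with `|capWit v| = 0` carry only this). [folklore] -/
theorem abs_yLim_le_one (hμ : IsInfiniteVolumeLimitAlong (suRep 2) (β / (2 : ℕ)) Lk μ) (v : Fin 10878) :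
    |yLim μ v| ≤ 1 := by
  haveI := hμ.1
  exact abs_integral_wordLoopZd_le_one (suRep 2) (continuous_suRep 2) μ 0 (KZL2rpD4.label v)

/-! ## (B) The per-variable boxes at limit points: `|yLim μ v| ≤ ρ^{m(v)}`, `m(v) = |capWit v|` -/

/-- **LIMIT BOXES, general `β`**: `|yLim μ v| ≤ ρ^{|capWit v|}` for ALL `v` at every limit point along a strictly increasing
sequence of tori, whenever `0 < β`, `0 ≤ ρ`, `I₂(6β)/I₁(6β) ≤ ρ` (limit of the torus boxes `abs_y_le_pow_capWit`, valid on
every torus `L ≥ 12`). [folklore] -/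
theorem abs_yLim_le_pow_capWit {ρ : ℝ} (hβ : 0 < β) (hρ0 : 0 ≤ ρ) (hρ : besselI 2 (6 * β) / besselI 1 (6 * β) ≤ ρ)
    (hmono : StrictMono Lk) (hμ : IsInfiniteVolumeLimitAlong (suRep 2) (β / (2 : ℕ)) Lk μ) (v : Fin 10878) :
    |yLim μ v| ≤ ρ ^ (KZL2rpD4.capWit v).length :=
  abs_integral_wordLoopZd_le_of_eventually (suRep 2) (continuous_suRep 2) hμ (KZL2rpD4.label v)
    (Filter.eventually_atTop.2 ⟨11, fun k hk => by
      have hk' : k ≤ Lk k := hmono.id_le k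
      have hL : 12 ≤ Lk k + 1 := by omega
      exact abs_y_le_pow_capWit hβ hρ0 hρ (Lk k + 1) hL v⟩)

/-- **LIMIT BOXES at `β_std = 9/5`**: `|yLim μ v| ≤ (2177/2500)^{|capWit v|}` for every `v` (the `bounds.abs` field of the
two `9/5` files, 10 836 keyed columns; the rest `m = 0`). [folklore] -/
theorem abs_yLim_le_pow_capWit_b9o5 (hmono : StrictMono Lk)
    (hμ : IsInfiniteVolumeLimitAlong (suRep 2) ((9 / 5 : ℝ) / (2 : ℕ)) Lk μ) (v : Fin 10878) :
    |yLim μ v| ≤ (2177 / 2500 : ℝ) ^ (KZL2rpD4.capWit v).length :=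
  abs_yLim_le_pow_capWit (by norm_num) (by norm_num) besselRatio_b9o5_le hmono hμ v

/-- **LIMIT BOXES at `β_std = 2`**: `|yLim μ v| ≤ (2207/2500)^{|capWit v|}`. [folklore] -/
theorem abs_yLim_le_pow_capWit_b2 (hmono : StrictMono Lk)
    (hμ : IsInfiniteVolumeLimitAlong (suRep 2) ((2 : ℝ) / (2 : ℕ)) Lk μ) (v : Fin 10878) :
    |yLim μ v| ≤ (2207 / 2500 : ℝ) ^ (KZL2rpD4.capWit v).length :=
  abs_yLim_le_pow_capWit (by norm_num) (by norm_num) besselRatio_b2_le hmono hμ v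

/-- **LIMIT BOXES at `β_std = 11/5`**: `|yLim μ v| ≤ (558/625)^{|capWit v|}` (the `bounds.abs` field of the `11/5` file).
[folklore] -/
theorem abs_yLim_le_pow_capWit_b11o5 (hmono : StrictMono Lk)
    (hμ : IsInfiniteVolumeLimitAlong (suRep 2) ((11 / 5 : ℝ) / (2 : ℕ)) Lk μ) (v : Fin 10878) :
    |yLim μ v| ≤ (558 / 625 : ℝ) ^ (KZL2rpD4.capWit v).length :=
  abs_yLim_le_pow_capWit (by norm_num) (by norm_num) besselRatio_b11o5_le hmono hμ v

/-- **LIMIT BOXES at `β_std = 12/5`**: `|yLim μ v| ≤ (9013/10000)^{|capWit v|}`. [folklore] -/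
theorem abs_yLim_le_pow_capWit_b12o5 (hmono : StrictMono Lk)
    (hμ : IsInfiniteVolumeLimitAlong (suRep 2) ((12 / 5 : ℝ) / (2 : ℕ)) Lk μ) (v : Fin 10878) :
    |yLim μ v| ≤ (9013 / 10000 : ℝ) ^ (KZL2rpD4.capWit v).length :=
  abs_yLim_le_pow_capWit (by norm_num) (by norm_num) besselRatio_b12o5_le hmono hμ v

/-! ## (D) The dictionary: the cap-object columns `0, 1, 2, 5, 27, 13` are rectangles `t × m` in the `(0,1)` plane -/

/-- Column `1` is the `1 × 1` rectangle word (the plaquette). [folklore] -/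
theorem label_one_eq_rectangle : KZL2rpD4.label 1 = Word.rectangle 0 1 1 1 := by rw [KZL2rpD4.label_one]; rfl

/-- Column `5` of the kz-L2-rp-4D files is the `3 × 1` rectangle word `+e₀+e₀+e₀+e₁−e₀−e₀−e₀−e₁`. [folklore] -/
theorem label_five : KZL2rpD4.label 5 = [.fwd 0, .fwd 0, .fwd 0, .fwd 1, .bwd 0, .bwd 0, .bwd 0, .bwd 1] := by
  decide +kernel

/-- Column `27` of the kz-L2-rp-4D files is the `4 × 1` rectangle word `(+e₀)⁴ +e₁ (−e₀)⁴ −e₁`. [folklore] -/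
theorem label_twentyseven : KZL2rpD4.label 27 =
    [.fwd 0, .fwd 0, .fwd 0, .fwd 0, .fwd 1, .bwd 0, .bwd 0, .bwd 0, .bwd 0, .bwd 1] := by
  decide +kernel

/-- Column `5` as a rectangle word: `label 5 = Word.rectangle 0 1 3 1`. [folklore] -/
theorem label_five_eq_rectangle : KZL2rpD4.label 5 = Word.rectangle 0 1 3 1 := by rw [label_five]; rfl

/-- Column `27` as a rectangle word: `label 27 = Word.rectangle 0 1 4 1`. [folklore] -/
theorem label_twentyseven_eq_rectangle : KZL2rpD4.label 27 = Word.rectangle 0 1 4 1 := by rw [label_twentyseven]; rfl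

/-- **Rectangle columns have the rectangle limit**: if `label v = rectangle 0 1 t m` then `yLim μ v = g_m(t) = gLim μ 1 m t`
(both are limits of the same torus sequence `⟨W̄(t×m)⟩_{L_k+1}`; any `β`). [folklore] -/
theorem yLim_eq_gLim (hμ : IsInfiniteVolumeLimitAlong (suRep 2) (β / (2 : ℕ)) Lk μ) {v : Fin 10878} {t m : ℕ}
    (hv : KZL2rpD4.label v = Word.rectangle 0 1 t m) : yLim μ v = gLim μ 1 m t := by
  have h1 := tendsto_y_yLim hμ v
  have h2 := tendsto_wilsonExpectation_wilsonLoop hμ (1 : Fin 4) t m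
  have e : ∀ k, KZL2rpD4.y β (Lk k + 1) v =
      wilsonExpectation (suRep 2) (β / (2 : ℕ)) (wilsonLoop (suRep 2) (0 : Site 4 (Lk k + 1)) 0 1 t m) := fun k => by
    rw [wilsonExpectation_wilsonLoop_eq_wilsonLoopExpectation (Lk k + 1) β 0 (show (0 : Fin 4) ≠ 1 by decide),
      wilsonLoopExpectation_two_four_eq, ← hv]
    rfl
  exact tendsto_nhds_unique h1 ((h2.congr fun k => (e k).symm))

/-- `yLim μ 1 = g₁(1)` (plaquette). [folklore] -/
theorem yLim_one (hμ : IsInfiniteVolumeLimitAlong (suRep 2) (β / (2 : ℕ)) Lk μ) : yLim μ 1 = gLim μ 1 1 1 :=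
  yLim_eq_gLim hμ label_one_eq_rectangle

/-- `yLim μ 2 = g₁(2)` (`2 × 1`). [folklore] -/
theorem yLim_two (hμ : IsInfiniteVolumeLimitAlong (suRep 2) (β / (2 : ℕ)) Lk μ) : yLim μ 2 = gLim μ 1 1 2 :=
  yLim_eq_gLim hμ KZL2rpD4.label_two_eq_rectangle

/-- `yLim μ 5 = g₁(3)` (`3 × 1`). [folklore] -/
theorem yLim_five (hμ : IsInfiniteVolumeLimitAlong (suRep 2) (β / (2 : ℕ)) Lk μ) : yLim μ 5 = gLim μ 1 1 3 :=
  yLim_eq_gLim hμ label_five_eq_rectangle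

/-- `yLim μ 27 = g₁(4)` (`4 × 1`). [folklore] -/
theorem yLim_twentyseven (hμ : IsInfiniteVolumeLimitAlong (suRep 2) (β / (2 : ℕ)) Lk μ) :
    yLim μ 27 = gLim μ 1 1 4 :=
  yLim_eq_gLim hμ label_twentyseven_eq_rectangle

/-- `yLim μ 13 = g₂(2)` (`2 × 2`). [folklore] -/
theorem yLim_thirteen (hμ : IsInfiniteVolumeLimitAlong (suRep 2) (β / (2 : ℕ)) Lk μ) : yLim μ 13 = gLim μ 1 2 2 :=
  yLim_eq_gLim hμ KZL2rpD4.label_thirteen_eq_rectangle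

/-- `yLim μ 2 = g₂(1)` (`W̄(1×2) = W̄(2×1)` at limit points, `WilsonLoopLimit.wilsonLoop_integral_limit_comm`). [folklore] -/
theorem yLim_two' (hμ : IsInfiniteVolumeLimitAlong (suRep 2) (β / (2 : ℕ)) Lk μ) : yLim μ 2 = gLim μ 1 2 1 := by
  rw [yLim_two hμ, gLim_eq, gLim_eq]
  exact wilsonLoop_integral_limit_comm hμ (show (1 : Fin 4) ≠ 0 by decide) 2 1

/-- `yLim μ 0 = g₁(0) = 1` (unit column vs height-zero rectangle). [folklore] -/
theorem yLim_zero_eq_gLim (hμ : IsInfiniteVolumeLimitAlong (suRep 2) (β / (2 : ℕ)) Lk μ) : yLim μ 0 = gLim μ 1 1 0 := by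
  rw [yLim_zero hμ, gLim_eq, wilsonLoop_integral_limit_height_zero (by norm_num) hμ 1 1]

/-- A double sum over `range 2`, written out. [folklore] -/
theorem sum_range_two_two (F : ℕ → ℕ → ℝ) :
    ∑ a ∈ range 2, ∑ b ∈ range 2, F a b = F 0 0 + F 0 1 + (F 1 0 + F 1 1) := by
  simp only [sum_range_succ, sum_range_zero, zero_add]

/-! ## (C) The six cap objects of the `9/5` files (`ρ = 2177/2500`, `ρ² = 4739329/6250000`), every limit point along even tori -/

section B9o5

variable (hmono : StrictMono Lk) (heven : ∀ k, Even (Lk k + 1))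
  (hμ : IsInfiniteVolumeLimitAlong (suRep 2) ((9 / 5 : ℝ) / (2 : ℕ)) Lk μ)
include hmono heven hμ

/-- `hdcap/R1/mono t=1` of the `9/5` files: `y₂ − ρ y₁ ≤ 0`. [folklore] -/
theorem capObj_b9o5_mono_R1_t1 : yLim μ 2 ≤ (2177 / 2500 : ℝ) * yLim μ 1 := by
  rw [yLim_two hμ, yLim_one hμ]
  exact limit_monocap_one_b9o5 hmono heven hμ (show (1 : Fin 4) ≠ 0 by decide) le_rfl 1

/-- `hdcap/R1/mono t=2`: `y₅ − ρ y₂ ≤ 0`. [folklore] -/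
theorem capObj_b9o5_mono_R1_t2 : yLim μ 5 ≤ (2177 / 2500 : ℝ) * yLim μ 2 := by
  rw [yLim_five hμ, yLim_two hμ]
  exact limit_monocap_one_b9o5 hmono heven hμ (show (1 : Fin 4) ≠ 0 by decide) le_rfl 2

/-- `hdcap/R1/mono t=3`: `y₂₇ − ρ y₅ ≤ 0`. [folklore] -/
theorem capObj_b9o5_mono_R1_t3 : yLim μ 27 ≤ (2177 / 2500 : ℝ) * yLim μ 5 := by
  rw [yLim_twentyseven hμ, yLim_five hμ]
  exact limit_monocap_one_b9o5 hmono heven hμ (show (1 : Fin 4) ≠ 0 by decide) le_rfl 3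

/-- `hdcap/R2/mono t=1`: `y₁₃ − ρ² y₂ ≤ 0` (`ρ² = 4739329/6250000`). [folklore] -/
theorem capObj_b9o5_mono_R2_t1 : yLim μ 13 ≤ (2177 / 2500 : ℝ) ^ 2 * yLim μ 2 := by
  rw [yLim_thirteen hμ, yLim_two' hμ]
  exact limit_monocap_sq_b9o5 hmono heven hμ (show (1 : Fin 4) ≠ 0 by decide) le_rfl 1

/-- `hdcap/R1/D0cap{0..1}` of the `9/5` files: the `2 × 2` block with entries `(0,0) = ρ y₀ − y₁`, `(0,1) = ρ y₁ − y₂`,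
`(1,1) = ρ y₂ − y₅` is positive semidefinite (all real `c₀, c₁`). [folklore] -/
theorem capObj_b9o5_D0cap (c₀ c₁ : ℝ) :
    0 ≤ c₀ * c₀ * ((2177 / 2500 : ℝ) * yLim μ 0 - yLim μ 1) + c₀ * c₁ * ((2177 / 2500 : ℝ) * yLim μ 1 - yLim μ 2) +
      c₁ * c₀ * ((2177 / 2500 : ℝ) * yLim μ 1 - yLim μ 2) + c₁ * c₁ * ((2177 / 2500 : ℝ) * yLim μ 2 - yLim μ 5) := by
  have h := limit_hdcap_site_one_b9o5 hmono heven hμ (show (1 : Fin 4) ≠ 0 by decide) (le_rfl : 1 ≤ 1) (range 2)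
    (fun a => if a = 0 then c₀ else c₁)
  rw [sum_range_two_two] at h
  norm_num at h
  rw [yLim_zero_eq_gLim hμ, yLim_one hμ, yLim_two hμ, yLim_five hμ]
  linarith [h]

/-- `hdcap/R1/D1cap{0..1}` of the `9/5` files: the `2 × 2` block with entries `(0,0) = ρ y₁ − y₂`, `(0,1) = ρ y₂ − y₅`,
`(1,1) = ρ y₅ − y₂₇` is positive semidefinite (all real `c₀, c₁`). [folklore] -/
theorem capObj_b9o5_D1cap (c₀ c₁ : ℝ) :
    0 ≤ c₀ * c₀ * ((2177 / 2500 : ℝ) * yLim μ 1 - yLim μ 2) + c₀ * c₁ * ((2177 / 2500 : ℝ) * yLim μ 2 - yLim μ 5) +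
      c₁ * c₀ * ((2177 / 2500 : ℝ) * yLim μ 2 - yLim μ 5) + c₁ * c₁ * ((2177 / 2500 : ℝ) * yLim μ 5 - yLim μ 27) := by
  have h := limit_hdcap_link_one_b9o5 hmono heven hμ (show (1 : Fin 4) ≠ 0 by decide) (le_rfl : 1 ≤ 1) (range 2)
    (fun a => if a = 0 then c₀ else c₁)
  rw [sum_range_two_two] at h
  norm_num at h
  rw [yLim_one hμ, yLim_two hμ, yLim_five hμ, yLim_twentyseven hμ]
  linarith [h]

end B9o5

/-! ## (C) The six cap objects of the `11/5` file (`ρ = 558/625`, `ρ² = 311364/390625`), every limit point along even tori -/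

section B11o5

variable (hmono : StrictMono Lk) (heven : ∀ k, Even (Lk k + 1))
  (hμ : IsInfiniteVolumeLimitAlong (suRep 2) ((11 / 5 : ℝ) / (2 : ℕ)) Lk μ)
include hmono heven hμ

/-- `hdcap/R1/mono t=1` of the `11/5` file: `y₂ − ρ y₁ ≤ 0`. [folklore] -/
theorem capObj_b11o5_mono_R1_t1 : yLim μ 2 ≤ (558 / 625 : ℝ) * yLim μ 1 := by
  rw [yLim_two hμ, yLim_one hμ]
  exact limit_monocap_one_b11o5 hmono heven hμ (show (1 : Fin 4) ≠ 0 by decide) le_rfl 1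

/-- `hdcap/R1/mono t=2`: `y₅ − ρ y₂ ≤ 0`. [folklore] -/
theorem capObj_b11o5_mono_R1_t2 : yLim μ 5 ≤ (558 / 625 : ℝ) * yLim μ 2 := by
  rw [yLim_five hμ, yLim_two hμ]
  exact limit_monocap_one_b11o5 hmono heven hμ (show (1 : Fin 4) ≠ 0 by decide) le_rfl 2

/-- `hdcap/R1/mono t=3`: `y₂₇ − ρ y₅ ≤ 0`. [folklore] -/
theorem capObj_b11o5_mono_R1_t3 : yLim μ 27 ≤ (558 / 625 : ℝ) * yLim μ 5 := by
  rw [yLim_twentyseven hμ, yLim_five hμ]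
  exact limit_monocap_one_b11o5 hmono heven hμ (show (1 : Fin 4) ≠ 0 by decide) le_rfl 3

/-- `hdcap/R2/mono t=1`: `y₁₃ − ρ² y₂ ≤ 0` (`ρ² = 311364/390625`). [folklore] -/
theorem capObj_b11o5_mono_R2_t1 : yLim μ 13 ≤ (558 / 625 : ℝ) ^ 2 * yLim μ 2 := by
  rw [yLim_thirteen hμ, yLim_two' hμ]
  exact limit_monocap_sq_b11o5 hmono heven hμ (show (1 : Fin 4) ≠ 0 by decide) le_rfl 1

/-- `hdcap/R1/D0cap{0..1}` of the `11/5` file (entries `ρ y₀ − y₁`, `ρ y₁ − y₂`, `ρ y₂ − y₅`), PSD. [folklore] -/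
theorem capObj_b11o5_D0cap (c₀ c₁ : ℝ) :
    0 ≤ c₀ * c₀ * ((558 / 625 : ℝ) * yLim μ 0 - yLim μ 1) + c₀ * c₁ * ((558 / 625 : ℝ) * yLim μ 1 - yLim μ 2) +
      c₁ * c₀ * ((558 / 625 : ℝ) * yLim μ 1 - yLim μ 2) + c₁ * c₁ * ((558 / 625 : ℝ) * yLim μ 2 - yLim μ 5) := by
  have h := limit_hdcap_site_one_b11o5 hmono heven hμ (show (1 : Fin 4) ≠ 0 by decide) (le_rfl : 1 ≤ 1) (range 2)
    (fun a => if a = 0 then c₀ else c₁)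
  rw [sum_range_two_two] at h
  norm_num at h
  rw [yLim_zero_eq_gLim hμ, yLim_one hμ, yLim_two hμ, yLim_five hμ]
  linarith [h]

/-- `hdcap/R1/D1cap{0..1}` of the `11/5` file (entries `ρ y₁ − y₂`, `ρ y₂ − y₅`, `ρ y₅ − y₂₇`), PSD. [folklore] -/
theorem capObj_b11o5_D1cap (c₀ c₁ : ℝ) :
    0 ≤ c₀ * c₀ * ((558 / 625 : ℝ) * yLim μ 1 - yLim μ 2) + c₀ * c₁ * ((558 / 625 : ℝ) * yLim μ 2 - yLim μ 5) +
      c₁ * c₀ * ((558 / 625 : ℝ) * yLim μ 2 - yLim μ 5) + c₁ * c₁ * ((558 / 625 : ℝ) * yLim μ 5 - yLim μ 27) := by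
  have h := limit_hdcap_link_one_b11o5 hmono heven hμ (show (1 : Fin 4) ≠ 0 by decide) (le_rfl : 1 ≤ 1) (range 2)
    (fun a => if a = 0 then c₀ else c₁)
  rw [sum_range_two_two] at h
  norm_num at h
  rw [yLim_one hμ, yLim_two hμ, yLim_five hμ, yLim_twentyseven hμ]
  linarith [h]

end B11o5

end Summit.QuantumFields.YangMills.Theorems.Instrument

end
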